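import Literature.Computability.Complexity.PromiseMA
import Literature.Computability.Complexity.Nondeterministic
import Literature.Computability.Complexity.CoinTruncation
import Literature.Computability.Complexity.CountingHierarchyProofs
import Literature.Computability.Complexity.CoinCounting
import Literature.Computability.Complexity.LengthCompare
import Literature.Computability.Complexity.StringCopy
import Literature.Computability.Complexity.TM2Iterate
import HarnessLib

/-!
# The witness operator on promise classes (`pr∃·`) and `pr-MA ⊆ pr∃·pr-BPP`

Literature / complexity classes, companion of `Nondeterministic.lean` (`polyExists C = ∃·C` on classes of
LANGUAGES, Arora–Barak Def. 5.3; Gharibian–Santha–Sikora–Sundaram–Yirka 2022, Def. 3.6) and of `PromiseMA.lean`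
(`PromiseMA'`, the textbook promise class `pr-MA`).

Gharibian et al. (Comput. Complexity 31 (2022), Remark 3.7 "Languages versus promise problems") point out
that the language operator `∃·` applied to a SEMANTIC class does not give the expected class: `∃·BPP` is
(as far as anyone knows) smaller than `MA` — "whether `∃·BPP = MA` remains an open question [FFKL03]" —
because a `BPP` verifier must have bounded error on EVERY pair `⟨x, y⟩`, whereas Merlin–Arthur only
constrains the honest/dishonest messages on the promise. The remedy used throughout the literature
(their Def. 2.2 of `QCΣᵢ` on promise problems; Dixon–Pavan–Vander Woude–Vinodchandran 2022, proof of
Thm. 5.2: "`MA = ∃•PromiseBPP`") is to apply the witness operator to a class of PROMISE PROBLEMS. This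
file vendors that operator and the two facts about it that are used downstream:

* `prPolyExists 𝒞` — `Q ∈ pr∃·𝒞` iff there are an inner promise problem `T ∈ 𝒞` and a polynomial `p`
  such that every yes-instance `x` has a witness `y`, `|y| ≤ p(|x|)`, with `⟨x, y⟩ ∈ T.yes`, and for every
  no-instance `x` EVERY `y` with `|y| ≤ p(|x|)` has `⟨x, y⟩ ∈ T.no` (witness-length convention `≤ p(|x|)`
  as in the tree's `polyExists` and GSSSY Def. 3.6);
* `ofLanguage_mem_prPolyExists_iff` — on languages (trivial promises) it IS `polyExists`:
  `ofLanguage L ∈ pr∃·(ofLanguage '' C) ↔ L ∈ ∃·C`;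
* `prPolyExists_subset_promiseLift_polyExists` — **the witness operator commutes with promise lifts**:
  if every problem of `𝒞` is solved by (separated by) a language of `C` (`𝒞 ⊆ promiseLift C`), then
  every problem of `pr∃·𝒞` is solved by a language of `∃·C`. This is the one-line engine of DPVwV
  Thm. 5.1/5.2 ("if PromiseBPP has a solution in `C` then `MA = ∃·C`");
* `PromiseMA'_subset_prPolyExists_PromiseBPP'` — `pr-MA ⊆ pr∃·pr-BPP` (DPVwV: "`MA = ∃•PromiseBPP`",
  the inclusion that is used): the inner problem asks, on `⟨x, y⟩` with `|y| = p(|x|)`, whether Arthur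
  accepts Merlin's message `y` with probability `≥ 2/3` (yes) or `≤ 1/3` (no); malformed messages are
  no-instances. Its `pr-BPP` machine reads `p(|x|)` of its coins (`uniformProb_take_of_le`) and checks
  `|y| = p(|x|)` (`LenEq`);
* `MA_subset_polyExists_of_PromiseBPP'_subset_promiseLift` — hence `pr-BPP ⊆ promiseLift C ⟹ MA ⊆ ∃·C`
  (DPVwV Thm. 5.2, first half, with `C` for `ZPP`/`BPP`).

Everything here is proved. Mathlib has no promise classes; nothing duplicates the tree (searched
`prPolyExists`, `PromiseQCMA`, `∃•`, `polyExists.*Promise`: none). Deliberately NOT here: the converse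
`pr∃·pr-BPP ⊆ pr-MA` (true, by padding the witness to exact length; not needed downstream), and any
quantum class (see `Summits/QuantumAdvantage/…/Theorems/SoloInformedDoorFloor.lean`, which instantiates
the operator at `PromiseBQP`, i.e. promise-`QCMA`).

## References

* S. Gharibian, M. Santha, J. Sikora, A. Sundaram, J. Yirka, *Quantum generalizations of the polynomial
  hierarchy with applications to QMA(2)*, Comput. Complexity 31 (2022), Def. 2.2 (`QCΣᵢ` on promise
  problems), Def. 3.6 (`∃·C`, `|y| ≤ p(|x|)`), Remark 3.7 (languages versus promise problems;
  "`∃·BPP = MA` open") [GharibianEtAl2022].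
* P. Dixon, A. Pavan, J. Vander Woude, N. V. Vinodchandran, *Pseudodeterminism: promises and lowerbounds*,
  STOC 2022, Thm. 5.1 and proof of Thm. 5.2 ("Since `MA = ∃•PromiseBPP` …") [DixonPavanVanderWoudeVinodchandran2022].
* S. Arora, B. Barak, *Computational Complexity*, CUP 2009, Def. 5.3 / Rem. 5.8 (the `∃` operator),
  Def. 7.3 (coins of a fixed polynomial length), Def. 8.10 (`MA`) [AroraBarakCC2009].
* O. Goldreich, *On promise problems: a survey*, LNCS 3895 (2006), Def. 1.2 (promise classes; nothing is
  required off the promise) [Goldreich2006].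
-/

noncomputable section

namespace Literature.Computability.Complexity

open _root_.Computability Brick

/-! ### The operator -/

/-- **The witness operator on promise classes**, `pr∃·𝒞`: `Q ∈ prPolyExists 𝒞` iff there are an inner
promise problem `T ∈ 𝒞` and a polynomial `p` such that (yes) every `x ∈ Q.yes` has a witness `y` with
`|y| ≤ p(|x|)` and `⟨x, y⟩ ∈ T.yes`, and (no) for every `x ∈ Q.no`, every `y` with `|y| ≤ p(|x|)` has
`⟨x, y⟩ ∈ T.no`. With `𝒞 = PromiseBPP'` this is the class whose languages are `MA` ("`MA = ∃•PromiseBPP`");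
with `𝒞 = PromiseBQP` it is promise-`QCMA` (`QCΣ₁`), up to the witness-length convention (`≤ p(|x|)` here and
in Def. 3.6, `= p(n)` in Def. 2.2). [cite: GharibianEtAl2022, Def. 3.6 and Rem. 3.7; Def. 2.2] -/
def prPolyExists (𝒞 : Set PromiseProblem) : Set PromiseProblem :=
  {Q | ∃ T ∈ 𝒞, ∃ p : Polynomial ℕ,
    (∀ x ∈ Q.yes, ∃ y : List Bool, y.length ≤ p.eval x.length ∧ boolPair x y ∈ T.yes) ∧
    (∀ x ∈ Q.no, ∀ y : List Bool, y.length ≤ p.eval x.length → boolPair x y ∈ T.no)}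

/-- Unfolding lemma for `prPolyExists`. [cite: GharibianEtAl2022, Def. 3.6] -/
theorem mem_prPolyExists_iff {𝒞 : Set PromiseProblem} {Q : PromiseProblem} :
    Q ∈ prPolyExists 𝒞 ↔ ∃ T ∈ 𝒞, ∃ p : Polynomial ℕ,
      (∀ x ∈ Q.yes, ∃ y : List Bool, y.length ≤ p.eval x.length ∧ boolPair x y ∈ T.yes) ∧
      (∀ x ∈ Q.no, ∀ y : List Bool, y.length ≤ p.eval x.length → boolPair x y ∈ T.no) :=
  Iff.rfl

/-- `prPolyExists` is monotone in the class. [cite: GharibianEtAl2022, Def. 3.6] -/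
theorem prPolyExists_mono {𝒞 𝒟 : Set PromiseProblem} (h : 𝒞 ⊆ 𝒟) : prPolyExists 𝒞 ⊆ prPolyExists 𝒟 := by
  rintro Q ⟨T, hT, p, hyes, hno⟩
  exact ⟨T, h hT, p, hyes, hno⟩

/-- **On languages the promise operator is the language operator**: for a class of languages `C`,
`ofLanguage L ∈ pr∃·(ofLanguage '' C) ↔ L ∈ ∃·C` (`polyExists`). [cite: GharibianEtAl2022, Def. 3.6 and Rem. 3.7] -/
theorem ofLanguage_mem_prPolyExists_iff {C : Set (Language Bool)} {L : Language Bool} :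
    PromiseProblem.ofLanguage L ∈ prPolyExists (PromiseProblem.ofLanguage '' C) ↔ L ∈ polyExists C := by
  constructor
  · rintro ⟨T, ⟨L', hL', rfl⟩, p, hyes, hno⟩
    refine ⟨L', hL', p, fun x => ⟨fun hx => hyes x hx, fun ⟨y, hy, hxy⟩ => ?_⟩⟩
    by_contra hx
    exact absurd hxy (hno x hx y hy)
  · rintro ⟨L', hL', p, hp⟩
    refine ⟨PromiseProblem.ofLanguage L', ⟨L', hL', rfl⟩, p, fun x hx => (hp x).1 hx, fun x hx y hy hxy => ?_⟩
    exact absurd ((hp x).2 ⟨y, hy, hxy⟩) hx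

/-- **The witness operator commutes with promise lifts** (the engine of DPVwV Thm. 5.1/5.2): if every
problem of `𝒞` is solved by a language of `C`, then every problem of `pr∃·𝒞` is solved by a language of
`∃·C` — namely by `{x | ∃ y, |y| ≤ p(|x|) ∧ ⟨x, y⟩ ∈ L'}` for a solution `L' ∈ C` of the inner problem.
[cite: DixonPavanVanderWoudeVinodchandran2022, Thm. 5.1 (proof) and Thm. 5.2 (proof)] -/
theorem prPolyExists_subset_promiseLift_polyExists {𝒞 : Set PromiseProblem} {C : Set (Language Bool)}
    (h : 𝒞 ⊆ promiseLift C) : prPolyExists 𝒞 ⊆ promiseLift (polyExists C) := by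
  rintro Q ⟨T, hT, p, hyes, hno⟩
  obtain ⟨L', hL'C, hTy, hTn⟩ := h hT
  refine ⟨{x : List Bool | ∃ y : List Bool, y.length ≤ p.eval x.length ∧ boolPair x y ∈ L'},
    ⟨L', hL'C, p, fun x => Iff.rfl⟩, fun x hx => ?_, fun x hx hxL => ?_⟩
  · obtain ⟨y, hy, hxy⟩ := hyes x hx
    exact ⟨y, hy, hTy hxy⟩
  · obtain ⟨y, hy, hxy⟩ := hxL
    exact absurd hxy (hTn (hno x hx y hy))

/-- The language form: `𝒞 ⊆ promiseLift C` and `ofLanguage L ∈ pr∃·𝒞` give `L ∈ ∃·C`.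
[cite: DixonPavanVanderWoudeVinodchandran2022, Thm. 5.2 (proof)] -/
theorem mem_polyExists_of_ofLanguage_mem_prPolyExists {𝒞 : Set PromiseProblem} {C : Set (Language Bool)}
    (h : 𝒞 ⊆ promiseLift C) {L : Language Bool} (hL : PromiseProblem.ofLanguage L ∈ prPolyExists 𝒞) :
    L ∈ polyExists C :=
  ofLanguage_mem_promiseLift_iff.1 (prPolyExists_subset_promiseLift_polyExists h hL)

/-! ### `pr-MA ⊆ pr∃·pr-BPP` -/

namespace PrMAWitness

/-- Pointwise pairing of two `FP` functions is in `FP` (local helper, as in `PromiseMA.lean`). [folklore] -/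
private theorem pair_mem_FP {f g : List Bool → List Bool} (hf : f ∈ FP) (hg : g ∈ FP) :
    (fun z => boolPair (f z) (g z)) ∈ FP := by
  have h : (fun z => boolPair (f z) (g z)) = fanoutFn f g := funext fun z => (fanoutFn_apply f g z).symm
  rw [h]
  exact fanoutFn_mem_FP hf hg

/-- Membership in a set-builder language (local `Iff.rfl` helper). [folklore] -/
private theorem memL_setOf' {q : List Bool → Prop} {w : List Bool} :
    @Membership.mem (List Bool) (Language Bool) _ {z | q z} w ↔ q w := Iff.rfl

/-- The coin-reading map `⟨⟨x, y⟩, z⟩ ↦ ⟨⟨x, y⟩, z ↾ p(|x|)⟩` (Arthur reads the first `p(|x|)` of his coins),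
assembled from the tree's bricks `fstF`, `sndF`, `fanoutFn`, `truncSndFn`. [cite: AroraBarakCC2009, Def. 7.3] -/
def truncCoins (p : Polynomial ℕ) : List Bool → List Bool :=
  fanoutFn fstF (sndF ∘ truncSndFn p ∘ fanoutFn (fstF ∘ fstF) sndF)

/-- `truncCoins p ∈ FP`. [cite: AroraBarakCC2009, Def. 7.3] -/
theorem truncCoins_mem_FP (p : Polynomial ℕ) : truncCoins p ∈ FP :=
  fanoutFn_mem_FP fstF_mem_FP
    (comp_mem_FP sndF_mem_FP (comp_mem_FP (truncSndFn_mem_FP p)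
      (fanoutFn_mem_FP (comp_mem_FP fstF_mem_FP fstF_mem_FP) sndF_mem_FP)))

/-- Value of `truncCoins` on a triple. [cite: AroraBarakCC2009, Def. 7.3] -/
theorem truncCoins_apply (p : Polynomial ℕ) (x y z : List Bool) :
    truncCoins p (boolPair (boolPair x y) z) = boolPair (boolPair x y) (z.take (p.eval x.length)) := by
  simp only [truncCoins, fanoutFn_apply, Function.comp_apply, fstF_boolPair, sndF_boolPair,
    truncSndFn_boolPair]

/-- Arthur's referee for the inner problem: `|y| = p(|x|)` and `R` accepts `⟨⟨x, y⟩, z ↾ p(|x|)⟩`.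
[cite: AroraBarakCC2009, Def. 8.10] -/
def maRef (p : Polynomial ℕ) (R : Language Bool) : Language Bool :=
  {v | fstF v ∈ LenEq p ∧ truncCoins p v ∈ R}

/-- `maRef` as an intersection of two `FP`-preimages (definitionally). [folklore] -/
theorem maRef_eq (p : Polynomial ℕ) (R : Language Bool) :
    maRef p R = (fstF ⁻¹' LenEq p : Language Bool) ⊓ (truncCoins p ⁻¹' R : Language Bool) := rfl

/-- The referee is in `P` when `R` is. [cite: AroraBarakCC2009, Thm. 2.8] -/
theorem maRef_mem_P (p : Polynomial ℕ) {R : Language Bool} (hR : R ∈ Classes.P) : maRef p R ∈ Classes.P := by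
  rw [maRef_eq]
  exact inter_mem_P (preimage_mem_P (LenEq_mem_P p) fstF_mem_FP) (preimage_mem_P hR (truncCoins_mem_FP p))

/-- Reading the referee on a triple. [cite: AroraBarakCC2009, Def. 8.10] -/
theorem mem_maRef_iff (p : Polynomial ℕ) (R : Language Bool) (x y z : List Bool) :
    boolPair (boolPair x y) z ∈ maRef p R ↔
      y.length = p.eval x.length ∧ boolPair (boolPair x y) (z.take (p.eval x.length)) ∈ R := by
  rw [maRef, memL_setOf', fstF_boolPair, boolPair_mem_LenEq, truncCoins_apply]

/-- **The inner promise problem of an `MA` protocol** `(R, p)`: on well-formed pairs `⟨x, y⟩`, `|y| = p(|x|)`,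
yes = "Arthur accepts `y` with probability `≥ 2/3`", no = "with probability `≤ 1/3`"; a pair `⟨x, y⟩` with
`|y| ≠ p(|x|)` is a no-instance. [cite: DixonPavanVanderWoudeVinodchandran2022, Thm. 5.2 (proof: "MA = ∃•PromiseBPP")] -/
def maInner (p : Polynomial ℕ) (R : Language Bool) : PromiseProblem where
  yes := {w | ∃ x y : List Bool, w = boolPair x y ∧ y.length = p.eval x.length ∧
    2 / 3 ≤ uniformProb (p.eval x.length) {z : List Bool | boolPair (boolPair x y) z ∈ R}}
  no := {w | ∃ x y : List Bool, w = boolPair x y ∧ (y.length = p.eval x.length →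
    uniformProb (p.eval x.length) {z : List Bool | boolPair (boolPair x y) z ∈ R} ≤ 1 / 3)}

/-- **The inner problem is in `pr-BPP`**: Arthur, given `⟨x, y⟩` and `p(|⟨x, y⟩|) ≥ p(|x|)` coins, checks
`|y| = p(|x|)` and runs `R` on the first `p(|x|)` coins; the acceptance probability is that of the `MA`
protocol (`uniformProb_take_of_le`), and malformed pairs are rejected outright.
[cite: DixonPavanVanderWoudeVinodchandran2022, Thm. 5.2 (proof)] -/
theorem maInner_mem_PromiseBPP' (p : Polynomial ℕ) {R : Language Bool} (hR : R ∈ Classes.P) :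
    maInner p R ∈ PromiseBPP' := by
  have hle : ∀ x y : List Bool, p.eval x.length ≤ p.eval (boolPair x y).length := fun x y =>
    TM2Iter.eval_mono p (by rw [length_boolPair]; omega)
  refine ⟨maRef p R, maRef_mem_P p hR, p, ?_, ?_⟩
  · rintro w ⟨x, y, rfl, hy, hprob⟩
    have hset : {z : List Bool | boolPair (boolPair x y) z ∈ maRef p R} =
        {z : List Bool | z.take (p.eval x.length) ∈ {z' : List Bool | boolPair (boolPair x y) z' ∈ R}} := by
      ext z
      simp only [Set.mem_setOf_eq, mem_maRef_iff, hy, true_and]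
    rw [hset, uniformProb_take_of_le (hle x y)]
    exact hprob
  · rintro w ⟨x, y, rfl, himp⟩
    by_cases hy : y.length = p.eval x.length
    · have hprob := himp hy
      have hset : {z : List Bool | boolPair (boolPair x y) z ∉ maRef p R} =
          {z : List Bool | z.take (p.eval x.length) ∈ {z' : List Bool | boolPair (boolPair x y) z' ∈ R}ᶜ} := by
        ext z
        simp only [Set.mem_setOf_eq, mem_maRef_iff, hy, true_and, Set.mem_compl_iff]
      rw [hset, uniformProb_take_of_le (hle x y), Literature.Computability.Complexity.uniformProb_compl]
      linarith
    · have hset : {z : List Bool | boolPair (boolPair x y) z ∉ maRef p R} = Set.univ := by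
        refine Set.eq_univ_of_forall fun z => ?_
        simp only [Set.mem_setOf_eq, mem_maRef_iff, not_and]
        exact fun h => absurd h hy
      rw [hset, uniformProb_univ]
      norm_num

end PrMAWitness

open PrMAWitness in
/-- **`pr-MA ⊆ pr∃·pr-BPP`** ("`MA = ∃•PromiseBPP`", the inclusion used by DPVwV): the witness is Merlin's
message, the inner `pr-BPP` problem is Arthur's test on the promise "`y` is accepted with probability
`≥ 2/3` or `≤ 1/3`". [cite: DixonPavanVanderWoudeVinodchandran2022, Thm. 5.2 (proof)] -/
theorem PromiseMA'_subset_prPolyExists_PromiseBPP' : PromiseMA' ⊆ prPolyExists PromiseBPP' := by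
  rintro Q ⟨R, hR, p, hyes, hno⟩
  refine ⟨maInner p R, maInner_mem_PromiseBPP' p hR, p, fun x hx => ?_, fun x hx y hy => ?_⟩
  · obtain ⟨y, hy, hprob⟩ := hyes x hx
    exact ⟨y, hy.le, x, y, rfl, hy, hprob⟩
  · exact ⟨x, y, rfl, fun hlen => hno x hx y hlen⟩

/-- **`pr-BPP ⊆ promiseLift C ⟹ MA ⊆ ∃·C`** (DPVwV Thm. 5.2, first half, for an arbitrary class `C` of
languages in place of `ZPP`/`BPP`: "if PromiseBPP has a solution in `C` then `MA = ∃·C`", the inclusion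
`⊆`), through the tree's `ofLanguage_mem_PromiseMA'_of_mem_MA` (`MA` languages are `pr-MA` problems).
[cite: DixonPavanVanderWoudeVinodchandran2022, Thm. 5.1 and Thm. 5.2] -/
theorem MA_subset_polyExists_of_PromiseBPP'_subset_promiseLift {C : Set (Language Bool)}
    (h : PromiseBPP' ⊆ promiseLift C) : MA ⊆ polyExists C := fun _ hL =>
  mem_polyExists_of_ofLanguage_mem_prPolyExists h
    (PromiseMA'_subset_prPolyExists_PromiseBPP' (ofLanguage_mem_PromiseMA'_of_mem_MA hL))

end Literature.Computability.Complexity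

end
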